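import Literature.NumberTheory.EllipticCurves.HidaFamilyMembersProofs
import Literature.NumberTheory.EllipticCurves.CongruentNewformMultiplierProofs
import Literature.NumberTheory.EllipticCurves.EisensteinSeriesWeightTwoLevelRaised
import HarnessLib

/-!
# Congruent newforms in higher weight with a GENERAL multiplier and an AUXILIARY level
# (Deligne–Serre 6.9–6.11 at the primes `p = 2, 3`; proofs only)

Topic `Literature/NumberTheory/EllipticCurves`; namespace
`Literature.NumberTheory.EllipticCurves.ModularForms`.  THEOREMS ONLY (no definition, no named fact;
D-0026).  A companion of `HidaFamilyMembersProofs.exists_isNewform0_dvd_level_congr`, which produces,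
for a newform `f ∈ S_{k₀}(Γ₀(N))` and an even `w ≥ 4` with `(p - 1) ∣ w`, a congruent newform of weight
`k₀ + w` and level dividing `N` by multiplying `f` with the LEVEL-ONE Eisenstein series
`E_w ≡ 1 (mod p)` and lifting with the Deligne–Serre lemma.  That device cannot reach the weight
`k₀ + 2` (there is no holomorphic `E₂`), which is the weight asked for at `p = 3` by the companion-form
constructions of the BSD cell (`w = p - 1 = 2`).  Here the multiplier is arbitrary:

* `exists_isNewform0_dvd_level_congr_of_multiplier_of_dvd` — let `f ∈ S_{k₀}(Γ₀(N))` be a newform,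
  `k₀ ≥ 2`, `N ∣ N'`, and `G ∈ M_w(Γ₁(N'))` (`w ≥ 0`, `(p - 1) ∣ w`) a form invariant under all of
  `Γ₀(N')` whose `q`-expansion, read in `ℚ̄_p` through `ι : ℚ̄_p ≃ ℂ`, is `≡ 1` modulo the maximal
  ideal (`a₀(G) = 1`, `‖ι⁻¹ aⱼ(G)‖ < 1` for `j ≥ 1`).  Then there are `M ∣ N'` and a newform
  `g ∈ S_{k₀+w}(Γ₀(M))` with `‖ι⁻¹ a_q(g) - ι⁻¹ a_q(f)‖ < 1` for every prime `q ∤ N'`.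
  The proof is the one of `exists_isNewform0_dvd_level_congr` (Deligne–Serre 1974, 6.9–6.11 +
  Atkin–Lehner–Li), run at the AUXILIARY level `N'` with the Hecke family `{T_q : q ∤ N'}` only: away
  from `N'` the form `f · G ∈ S_{k₀+w}(N', 𝟙)` is an eigenvector modulo `𝔪` of `T_q` with eigenvalue
  `a_q(f)` (the weight enters the `q`-expansion of `T_q` only through `q^{k-1}`, and
  `q^{k₀+w-1} ≡ q^{k₀-1} (mod p)`); the Deligne–Serre lift is an eigenform of that family, and
  `exists_isNewform1_of_eigenpacket` needs eigenvalues only off the level.  Nothing is claimed at the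
  primes dividing `N'/N`.  (Name: the suffix `_of_dvd` records the hypothesis `N ∣ N'`; the
  same-level case `N' = N` with an arbitrary multiplier is also the tree's
  `exists_isNewform0_dvd_level_congr_of_multiplier` of `CongruentNewformMultiplierProofs.lean`, landed
  in the same commit by another seat — this file's theorem was renamed to keep the two apart, and the
  diamond-operator lemma `diamondOp_mulModularForm_of_forall_slash_eq` is imported from there.)
* `exists_isNewform0_dvd_level_congr_of_mazurMultiplier` — the multiplier
  `G = E₂^{(M)}/(1 - M)`, `E₂^{(M)} = E₂(z) - M E₂(Mz)` Mazur's weight-`2` Eisenstein series of a PRIME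
  level `M ∣ N'` (the tree's `mazurEisensteinMF`, `q`-expansion `qExpansion_coeff_mazurEisensteinMF`):
  its coefficients are `1` and `-24 (σ₁(n) - M[M ∣ n]σ₁(n/M))/(1 - M)`, so the congruence `G ≡ 1`
  holds as soon as `‖24/(1 - M)‖_p < 1`, i.e. `v_p(24) > v_p(M - 1)` — possible exactly at `p = 2, 3`.
  Conclusion: a congruent newform of weight `k₀ + 2` and level dividing `N'`.
* `exists_isNewform0_dvd_two_mul_level_congr_weight_add_two_three` — **at `p = 3`, EVERY newform
  `f ∈ S_{k₀}(Γ₀(N))`, `k₀ ≥ 2`, has a congruent newform of weight `k₀ + 2` and level dividing `2N`**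
  (auxiliary prime `M = 2`, `‖24/(1-2)‖₃ = 1/3`), congruence at every prime `q ∤ 2N`;
  `exists_isNewform0_dvd_level_congr_weight_add_two_three_of_prime_dvd` — level dividing `N` itself
  when `N` has a prime factor `M` with `3 ∤ M - 1`;
  `exists_isNewform0_dvd_two_mul_level_congr_weight_add_two_two` — the same at `p = 2`
  (`‖24‖₂ = 1/8`), level dividing `2N`.

What is NOT proved (said, not hidden): at `p = 3` a weight-`(k₀+2)` companion of level dividing `N`
when EVERY prime factor of `N` is `≡ 1 (mod 3)` — there the weight-`2` Eisenstein part of `M₂(Γ₀(N))`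
contains no form `≡ 1 (mod 3)` (all constant terms `1 - d`, `d ∣ N`, vanish mod `3`), and the
classical substitute is Katz's lift of the Hasse invariant (geometric mod-`p` modular forms), absent
from the tree; the auxiliary prime `2` is the replacement offered here.

## References

* P. Deligne, J.-P. Serre, *Formes modulaires de poids 1*, Ann. Sci. ÉNS (4) 7 (1974), 507–530,
  6.9–6.11. [DeligneSerreASENS1974]
* F. Diamond, J. Shurman, *A First Course in Modular Forms*, GTM 228 (2005), §1.2
  (`E₂(τ) - N E₂(Nτ) ∈ M₂(Γ₀(N))`), Prop. 5.8.5, Thm. 5.8.2–5.8.3. [DiamondShurman2005]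
* B. Mazur, *Modular curves and the Eisenstein ideal*, Publ. Math. IHÉS 47 (1977), II.5. [Mazur1977]
-/

noncomputable section

open scoped MatrixGroups ModularForm
open CongruenceSubgroup UpperHalfPlane

namespace Literature.NumberTheory.EllipticCurves.ModularForms

/-! ### Norm bookkeeping in `ℚ̄_p` (local copies of the private helpers of `HidaFamilyMembersProofs`) -/

section Norm

variable {p : ℕ} [Fact p.Prime]

/-- Chaining two congruences modulo `𝔪`. [folklore] -/
private theorem norm_sub_lt_one_trans' {x y z : PadicAlgCl p} (h₁ : ‖x - y‖ < 1)
    (h₂ : ‖y - z‖ < 1) : ‖x - z‖ < 1 := by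
  have : x - z = (x - y) + (y - z) := by ring
  rw [this]
  exact (PadicAlgCl.isNonarchimedean p _ _).trans_lt (max_lt h₁ h₂)

/-- Ultrametric inequality for differences. [folklore] -/
private theorem norm_sub_le_max'' (x y : PadicAlgCl p) : ‖x - y‖ ≤ max ‖x‖ ‖y‖ := by
  have h := PadicAlgCl.isNonarchimedean p x (-y)
  rwa [norm_neg, ← sub_eq_add_neg] at h

/-- An element congruent to an element of norm `1` has norm `1`. [folklore] -/
private theorem norm_eq_one_of_norm_sub_lt_one' {x y : PadicAlgCl p} (hy : ‖y‖ = 1)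
    (h : ‖x - y‖ < 1) : ‖x‖ = 1 := by
  apply le_antisymm
  · have h1 : x = (x - y) + y := by ring
    rw [h1]
    exact (PadicAlgCl.isNonarchimedean p _ _).trans (max_le h.le hy.le)
  · by_contra hlt
    push Not at hlt
    have h1 : y = x - (x - y) := by ring
    have h2 : ‖y‖ < 1 := by
      rw [h1]
      have h3 := PadicAlgCl.isNonarchimedean p x (-(x - y))
      rw [norm_neg, ← sub_eq_add_neg] at h3
      exact h3.trans_lt (max_lt hlt h)
    rw [hy] at h2
    exact lt_irrefl _ h2

/-- Algebraic integers of `ℚ̄_p` have norm at most one. [folklore] -/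
private theorem norm_le_one_of_isIntegral' {x : PadicAlgCl p} (hx : IsIntegral ℤ x) :
    ‖x‖ ≤ 1 := by
  have hv := Valuation.integer.integers (Valued.v (R := PadicAlgCl p))
  have hx' : IsIntegral (Valued.v (R := PadicAlgCl p)).integer x := hx.tower_top
  have h := (hv.isIntegral_iff_v_le_one).mp hx'
  rw [PadicAlgCl.valuation_def] at h
  exact_mod_cast h

/-- An integer divisible by `p` has norm `< 1` in `ℚ̄_p`. [folklore] -/
private theorem norm_intCast_lt_one_of_dvd' {z : ℤ} (hz : (p : ℤ) ∣ z) :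
    ‖(z : PadicAlgCl p)‖ < 1 := by
  rw [← map_intCast (algebraMap ℚ_[p] (PadicAlgCl p)) z]
  change ‖((z : ℚ_[p]) : PadicAlgCl p)‖ < 1
  rw [PadicAlgCl.norm_extends]
  exact Padic.norm_intCast_lt_one_iff.2 hz

/-- A finite sum of elements of norm `< 1` has norm `< 1` (ultrametric inequality). [folklore] -/
private theorem norm_sum_lt_one' {α : Type*} (s : Finset α) (u : α → PadicAlgCl p)
    (h : ∀ a ∈ s, ‖u a‖ < 1) : ‖∑ a ∈ s, u a‖ < 1 := by
  rcases s.eq_empty_or_nonempty with rfl | hs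
  · simp
  · obtain ⟨a, ha, hle⟩ := IsUltrametricDist.exists_norm_finsetSum_le_of_nonempty hs u
    exact hle.trans_lt (h a ha)

end Norm

/-! ### The Deligne–Serre companion with a general multiplier at an auxiliary level -/

section Multiplier

variable {p : ℕ} [Fact p.Prime]

set_option maxHeartbeats 1600000 in
/-- **Congruent newforms in higher weight with a general multiplier (Deligne–Serre), at an
auxiliary level.**  Let `p` be a prime, `ι : ℚ̄_p ≃ ℂ`, `f ∈ S_{k₀}(Γ₀(N))` a newform of weight
`k₀ ≥ 2`, `N ∣ N'`, and `G ∈ M_w(Γ₁(N'))` (`w` a natural number with `(p - 1) ∣ w`, the weight of `G`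
written `k₁ = w`) a modular form invariant under every `γ ∈ Γ₀(N')` whose `q`-expansion read through
`ι⁻¹` is congruent to `1` modulo the maximal ideal of `𝒪_{ℚ̄_p}`: `a₀(G) = 1` and `‖ι⁻¹ aⱼ(G)‖ < 1` for
`j ≥ 1`.  Then there are a divisor `M ∣ N'` and a newform `g ∈ S_{k₀+w}(Γ₀(M))` with
`‖ι⁻¹ a_q(g) - ι⁻¹ a_q(f)‖ < 1` for every prime `q ∤ N'`.  Proof: `x = f · G ∈ S_{k₀+w}(N', 𝟙)` has
`p`-integral coefficients congruent to those of `f`, hence is an eigenvector MODULO `𝔪` of every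
`T_q`, `q ∤ N'`, with eigenvalue `a_q(f)` (Diamond–Shurman Prop. 5.8.5 for `f`, Prop. 5.3.1 for
`T_q` in weight `k₀ + w`, and `q^{k₀+w-1} ≡ q^{k₀-1} (mod p)` by Fermat, both sides `≡ 0` for `q = p`
as `k₀ ≥ 2`); the Deligne–Serre lifting lemma (1974, 6.11; the tree's
`DeligneSerreLift.exists_eigenform_of_congruence` for the commuting family `{T_q : q ∤ N'}`) gives a
genuine eigenform of that family in `S_{k₀+w}(N', 𝟙)` with congruent eigenvalues, and its eigenpacket
away from `N'` is that of a newform of some level `M ∣ N'` (Atkin–Lehner–Li,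
`exists_isNewform1_of_eigenpacket`).  The level-one multiplier `G = E_w` and `N' = N` give back
`exists_isNewform0_dvd_level_congr`. [cite: DeligneSerreASENS1974, 6.9–6.11]
[cite: DiamondShurman2005, Thm. 5.8.2–5.8.3 and Prop. 5.8.5] -/
theorem exists_isNewform0_dvd_level_congr_of_multiplier_of_dvd (ι : PadicAlgCl p ≃+* ℂ) {N N' : ℕ}
    [NeZero N] [NeZero N'] (hNN' : N ∣ N')
    {k₀ : ℤ} (hk₀ : 2 ≤ k₀) {f : CuspForm (Gamma0 N) k₀} (hf : IsNewform0 f)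
    {w : ℕ} (hpw : (p - 1) ∣ w) {k₁ : ℤ} (hk₁ : k₁ = w) (G : ModularForm (Gamma1 N') k₁)
    (hGΓ : ∀ γ : SL(2, ℤ), γ ∈ Gamma0 N' → (⇑G : ℍ → ℂ) ∣[k₁] γ = ⇑G)
    (hG0 : (qExpansion 1 ⇑G).coeff 0 = 1)
    (hGm : ∀ j : ℕ, j ≠ 0 → ‖ι.symm ((qExpansion 1 ⇑G).coeff j)‖ < 1) :
    ∃ (M : ℕ) (_ : NeZero M) (_ : M ∣ N') (g : CuspForm (Gamma0 M) (k₀ + k₁)),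
      IsNewform0 g ∧
      ∀ q : ℕ, q.Prime → ¬ q ∣ N' →
        ‖ι.symm ((qExpansion 1 ⇑g).coeff q) - ι.symm ((qExpansion 1 ⇑f).coeff q)‖ < 1 := by
  classical
  subst hk₁
  have hp : p.Prime := Fact.out
  have hK1 : (1 : ℤ) ≤ k₀ + w := by omega
  have h1N := HeckeTGamma1.one_mem_strictPeriods_Gamma1 N'
  -- ### the form `x = f · G ∈ S_{k₀+w}(N', 𝟙)`
  set f₁ : CuspForm (Gamma1 N') k₀ := liftToGamma1 N' k₀ (toLevel0 hNN' k₀ f) with hf₁def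
  have hf₁ : ∀ n, cuspCoeff f₁ n = (qExpansion 1 ⇑f).coeff n := fun n ↦ by
    change (qExpansion 1 ⇑(liftToGamma1 N' k₀ (toLevel0 hNN' k₀ f))).coeff n = _
    rw [coe_liftToGamma1_holds N' k₀ (toLevel0 hNN' k₀ f), coe_toLevel0]
  let x : CuspForm (Gamma1 N') (k₀ + w) := f₁.mulModularForm G
  have hxq : qExpansion 1 ⇑x = qExpansion 1 ⇑f₁ * qExpansion 1 ⇑G := by
    change qExpansion 1 ⇑(f₁.mulModularForm G) = _
    rw [CuspForm.coe_mulModularForm]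
    exact ModularForm.qExpansion_mul_coe one_pos h1N f₁ G
  have hxmul : ∀ m, cuspCoeff x m = ∑ ij ∈ Finset.HasAntidiagonal.antidiagonal m,
      cuspCoeff f₁ ij.1 * (qExpansion 1 ⇑G).coeff ij.2 := fun m ↦ by
    change (qExpansion 1 ⇑x).coeff m = _
    rw [hxq, PowerSeries.coeff_mul]
    rfl
  -- ### norms: `a_n(f)` integral, `a_j(G) ∈ 𝔪` for `j ≠ 0`
  set A : ℕ → PadicAlgCl p := fun n ↦ ι.symm ((qExpansion 1 ⇑f).coeff n) with hA
  have hAint : ∀ n, ‖A n‖ ≤ 1 := fun n ↦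
    norm_le_one_of_isIntegral' ((IsNewform0.isIntegral_coeff_holds hf n).map
      (ι.symm : ℂ →+* PadicAlgCl p).toIntAlgHom)
  -- ### `x ≡ f`: `‖ι⁻¹ a_m(x) - ι⁻¹ a_m(f)‖ < 1`, `‖ι⁻¹ a_m(x)‖ ≤ 1`, `a_1(x) ≡ 1`
  have hxf : ∀ m, ‖ι.symm (cuspCoeff x m) - A m‖ < 1 := by
    intro m
    have hmem : (m, 0) ∈ Finset.HasAntidiagonal.antidiagonal m := by simp
    rw [hxmul, ← Finset.add_sum_erase _ _ hmem, hG0, mul_one, hf₁, map_add, hA,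
      add_sub_cancel_left, map_sum]
    refine norm_sum_lt_one' _ _ fun ij hij ↦ ?_
    obtain ⟨hne, hij'⟩ := Finset.mem_erase.mp hij
    have hj : ij.2 ≠ 0 := by
      intro h
      apply hne
      have := Finset.HasAntidiagonal.mem_antidiagonal.mp hij'
      rw [h, add_zero] at this
      exact Prod.ext this h
    rw [map_mul, hf₁, norm_mul]
    exact mul_lt_one_of_nonneg_of_lt_one_right (hAint _) (norm_nonneg _) (hGm _ hj)
  have hxint : ∀ m, ‖ι.symm (cuspCoeff x m)‖ ≤ 1 := fun m ↦ by
    have h1 : ι.symm (cuspCoeff x m) = (ι.symm (cuspCoeff x m) - A m) + A m := by ring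
    rw [h1]
    exact (PadicAlgCl.isNonarchimedean p _ _).trans (max_le (hxf m).le (hAint m))
  have hA1 : A 1 = 1 := by
    rw [hA]
    change ι.symm ((qExpansion 1 ⇑f).coeff 1) = 1
    rw [show (qExpansion 1 ⇑f).coeff 1 = 1 from hf.2.2, map_one]
  have hx1 : ‖ι.symm (cuspCoeff x 1)‖ = 1 :=
    norm_eq_one_of_norm_sub_lt_one' (y := A 1) (by rw [hA1, norm_one]) (hxf 1)
  -- ### `x ∈ S_{k₀+w}(N', 𝟙)`
  have hxdiam : ∀ d : (ZMod N')ˣ, diamondOp N' (k₀ + w) (d : ZMod N') x = x := fun d ↦ by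
    change diamondOp N' (k₀ + (w : ℤ)) (d : ZMod N') (f₁.mulModularForm G) = _
    rw [diamondOp_mulModularForm_of_forall_slash_eq G hGΓ (d : ZMod N') f₁, hf₁def,
      diamondOp_liftToGamma1 N' k₀ (d : ZMod N') (toLevel0 hNN' k₀ f)]
  have hxW : x ∈ nebentypusSubspace N' (k₀ + w) 1 := by
    rw [mem_nebentypusSubspace_iff_diamondOp]
    intro d
    rw [MulChar.one_apply_coe, one_smul]
    exact hxdiam d
  -- ### the Hecke relations of `f` (Diamond–Shurman Prop. 5.8.5) read in `ℚ̄_p`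
  -- exponents: `k₀ - 1 = e₀`, `k₀ + w - 1 = e₀ + w`
  obtain ⟨e₀, he₀⟩ : ∃ e₀ : ℕ, k₀ - 1 = (e₀ : ℤ) := ⟨(k₀ - 1).toNat, by omega⟩
  have he₀1 : 1 ≤ e₀ := by omega
  have hzpow₀ : ∀ q : ℕ, (q : ℂ) ^ (k₀ - 1) = ((q ^ e₀ : ℕ) : ℂ) := fun q ↦ by
    rw [he₀, zpow_natCast, Nat.cast_pow]
  have hzpow : ∀ q : ℕ, (q : ℂ) ^ (k₀ + (w : ℤ) - 1) = ((q ^ (e₀ + w) : ℕ) : ℂ) := fun q ↦ by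
    rw [show k₀ + (w : ℤ) - 1 = ((e₀ + w : ℕ) : ℤ) by push_cast; omega, zpow_natCast,
      Nat.cast_pow]
  -- `p ∣ q^{e₀+w} - q^{e₀}` for every prime `q`
  have hdvd : ∀ q : ℕ, q.Prime → (p : ℤ) ∣ ((q ^ (e₀ + w) : ℕ) : ℤ) - ((q ^ e₀ : ℕ) : ℤ) := by
    intro q hq
    have hfac : ((q ^ (e₀ + w) : ℕ) : ℤ) - ((q ^ e₀ : ℕ) : ℤ) =
        (q : ℤ) ^ e₀ * ((q : ℤ) ^ w - 1) := by push_cast; ring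
    rw [hfac]
    by_cases hqp : q = p
    · subst hqp
      exact Dvd.dvd.mul_right (dvd_pow_self (q : ℤ) (by omega)) _
    · apply Dvd.dvd.mul_left
      have hcop : IsCoprime (q : ℤ) p := by
        rw [Nat.isCoprime_iff_coprime]
        exact (Nat.coprime_primes hq hp).2 hqp
      obtain ⟨c, hc⟩ := hpw
      have h1 : (q : ℤ) ^ (p - 1) ≡ 1 [ZMOD p] := Int.ModEq.pow_card_sub_one_eq_one hp hcop
      have h2 : (q : ℤ) ^ w ≡ 1 [ZMOD p] := by
        rw [hc, pow_mul]
        simpa using h1.pow c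
      exact (Int.ModEq.dvd h2.symm)
  have hpowdiff : ∀ q : ℕ, q.Prime →
      ‖ι.symm (((q ^ (e₀ + w) : ℕ) : ℂ)) - ι.symm (((q ^ e₀ : ℕ) : ℂ))‖ < 1 := by
    intro q hq
    rw [map_natCast, map_natCast]
    have h := norm_intCast_lt_one_of_dvd' (hdvd q hq)
    push_cast at h ⊢
    exact h
  have hpownorm : ∀ q : ℕ, ‖ι.symm (((q ^ (e₀ + w) : ℕ) : ℂ))‖ ≤ 1 := fun q ↦ by
    rw [map_natCast, ← Int.cast_natCast]
    exact DeligneSerreLift.norm_intCast_le_one _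
  -- ### `(B)` `x` is an eigenvector modulo `𝔪` of every `T_q`, `q ∤ N'`, with eigenvalue `a_q(f)`
  have hcongT : ∀ (q : ℕ) (hq : q.Prime), ¬ q ∣ N' → ∀ n : ℕ,
      ‖ι.symm (cuspCoeff ((haveI : NeZero q := ⟨hq.ne_zero⟩;
          heckeT (Gamma1 N') (k₀ + w) q) x) n) - A q * ι.symm (cuspCoeff x n)‖ < 1 := by
    intro q hq hqN' n
    haveI : NeZero q := ⟨hq.ne_zero⟩
    have hqN : ¬ q ∣ N := fun h ↦ hqN' (h.trans hNN')
    -- `T_q` on `x` (weight `k₀ + w`, level `N'`, `q ∤ N'`)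
    have hTx := cuspCoeff_heckeT_gamma1 x q hq n
    -- the relation `a_{qn}(f) = a_q a_n - q^{k₀-1} a_{n/q}` (weight `k₀`, level `N`, `q ∤ N`)
    have hrel := IsNewform0.coeff_prime_mul hf hq n
    set D : ℕ → PadicAlgCl p := fun m ↦ ι.symm (cuspCoeff x m) - A m with hD
    have hDlt : ∀ m, ‖D m‖ < 1 := hxf
    have hxD : ∀ m, ι.symm (cuspCoeff x m) = A m + D m := fun m ↦ by rw [hD]; ring
    rw [if_neg hqN'] at hTx
    rw [if_neg hqN] at hrel
    obtain ⟨d, hd⟩ := (ZMod.isUnit_prime_iff_not_dvd hq).mpr hqN'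
    have hdiag : diamondOp N' (k₀ + w) (q : ZMod N') x = x := by rw [← hd]; exact hxdiam d
    rw [hdiag, hzpow q] at hTx
    rw [hzpow₀ q] at hrel
    by_cases hqn : q ∣ n
    · rw [if_pos hqn] at hTx hrel
      have e1 : ι.symm (cuspCoeff (heckeT (Gamma1 N') (k₀ + ↑w) q x) n) -
          A q * ι.symm (cuspCoeff x n) =
          D (q * n) - A q * D n +
            (ι.symm (((q ^ (e₀ + w) : ℕ) : ℂ)) * D (n / q) +
              (ι.symm (((q ^ (e₀ + w) : ℕ) : ℂ)) - ι.symm (((q ^ e₀ : ℕ) : ℂ))) *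
                A (n / q)) := by
        rw [hTx, map_add, map_mul, hxD, hxD n, hxD (n / q)]
        have : A (q * n) = A q * A n - ι.symm (((q ^ e₀ : ℕ) : ℂ)) * A (n / q) := by
          simp only [hA]
          rw [hrel, map_sub, map_mul, map_mul]
        rw [this]
        ring
      rw [e1]
      refine (PadicAlgCl.isNonarchimedean p _ _).trans_lt (max_lt ?_ ?_)
      · refine (norm_sub_le_max'' _ _).trans_lt (max_lt (hDlt _) ?_)
        rw [norm_mul]
        exact mul_lt_one_of_nonneg_of_lt_one_right (hAint q) (norm_nonneg _) (hDlt n)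
      · refine (PadicAlgCl.isNonarchimedean p _ _).trans_lt (max_lt ?_ ?_)
        · rw [norm_mul]
          exact mul_lt_one_of_nonneg_of_lt_one_right (hpownorm q) (norm_nonneg _) (hDlt _)
        · rw [norm_mul]
          exact mul_lt_one_of_nonneg_of_lt_one_left (norm_nonneg _) (hpowdiff q hq)
            (hAint _)
    · rw [if_neg hqn, mul_zero, add_zero] at hTx
      rw [if_neg hqn, mul_zero, sub_zero] at hrel
      have e1 : ι.symm (cuspCoeff (heckeT (Gamma1 N') (k₀ + ↑w) q x) n) -
          A q * ι.symm (cuspCoeff x n) = D (q * n) - A q * D n := by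
        rw [hTx, hxD, hxD n]
        have : A (q * n) = A q * A n := by
          simp only [hA]
          rw [hrel, map_mul]
        rw [this]
        ring
      rw [e1]
      refine (norm_sub_le_max'' _ _).trans_lt (max_lt (hDlt _) ?_)
      rw [norm_mul]
      exact mul_lt_one_of_nonneg_of_lt_one_right (hAint q) (norm_nonneg _) (hDlt n)
  -- ### `(C)` Deligne–Serre lifting inside `S_{k₀+w}(N', 𝟙)` for the family `{T_q : q ∤ N'}`
  let TL : ℕ → Module.End ℂ (CuspForm (Gamma1 N') (k₀ + w)) := fun q ↦
    if hq : q = 0 then 0 else (haveI : NeZero q := ⟨hq⟩; heckeT (Gamma1 N') (k₀ + w) q)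
  have hTL : ∀ (q : ℕ) (hq : q ≠ 0),
      TL q = (haveI : NeZero q := ⟨hq⟩; heckeT (Gamma1 N') (k₀ + w) q) := fun q hq ↦ dif_neg hq
  let 𝒯 : Set (Module.End ℂ (CuspForm (Gamma1 N') (k₀ + w))) :=
    {T | ∃ q : ℕ, q.Prime ∧ ¬ q ∣ N' ∧ T = TL q}
  have hcomm : ∀ S ∈ 𝒯, ∀ T ∈ 𝒯, Commute S T := by
    rintro S ⟨q, hq, -, rfl⟩ T ⟨q', hq', -, rfl⟩
    rw [hTL q hq.ne_zero, hTL q' hq'.ne_zero]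
    haveI : NeZero q := ⟨hq.ne_zero⟩
    haveI : NeZero q' := ⟨hq'.ne_zero⟩
    exact heckeT_comm_holds N' (k₀ + w) q q'
  have hdiam : ∀ T ∈ 𝒯, ∀ d : (ZMod N')ˣ,
      Commute T (diamondOp N' (k₀ + w) (d : ZMod N')) := by
    rintro T ⟨q, hq, -, rfl⟩ d
    rw [hTL q hq.ne_zero]
    haveI : NeZero q := ⟨hq.ne_zero⟩
    exact heckeT_diamondOp_comm_holds N' (k₀ + w) q (d : ZMod N')
  have hΛ : ∀ T ∈ 𝒯, ∀ y ∈ integralLattice1 N' (k₀ + w), T y ∈ integralLattice1 N' (k₀ + w) := by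
    rintro T ⟨q, hq, -, rfl⟩ y hy
    rw [hTL q hq.ne_zero]
    haveI : NeZero q := ⟨hq.ne_zero⟩
    exact heckeT_mem_integralLattice1 hK1 hy q hq
  -- the targets: any admissible congruence class (they are unique modulo `𝔪`)
  let P : Module.End ℂ (CuspForm (Gamma1 N') (k₀ + w)) → PadicAlgCl p → Prop := fun T c ↦
    ‖c‖ ≤ 1 ∧ ∀ n, ‖ι.symm (cuspCoeff (T x) n) - c * ι.symm (cuspCoeff x n)‖ < 1
  let a : Module.End ℂ (CuspForm (Gamma1 N') (k₀ + w)) → PadicAlgCl p := fun T ↦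
    if h : ∃ c, P T c then h.choose else 0
  have haP : ∀ T c, P T c → P T (a T) := by
    intro T c hc
    have h : ∃ c, P T c := ⟨c, hc⟩
    simp only [a, dif_pos h]
    exact h.choose_spec
  have hPuniq : ∀ T c₁ c₂, P T c₁ → P T c₂ → ‖c₁ - c₂‖ < 1 := by
    intro T c₁ c₂ h₁ h₂
    have h := norm_sub_lt_one_trans' (by rw [← norm_neg, neg_sub]; exact h₁.2 1) (h₂.2 1)
    rw [← sub_mul, norm_mul, hx1, mul_one] at h
    exact h
  have hPT : ∀ (q : ℕ) (hq : q.Prime), ¬ q ∣ N' → P (TL q) (A q) := by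
    intro q hq hqN'
    refine ⟨hAint q, fun n ↦ ?_⟩
    rw [hTL q hq.ne_zero]
    exact hcongT q hq hqN' n
  have ha : ∀ T ∈ 𝒯, ‖a T‖ ≤ 1 := by
    intro T hT
    by_cases h : ∃ c, P T c
    · exact (haP T _ h.choose_spec).1
    · simp only [a, dif_neg h, norm_zero]; exact zero_le_one
  have hcongr : ∀ T ∈ 𝒯, ∀ n,
      ‖ι.symm (cuspCoeff (T x) n) - a T * ι.symm (cuspCoeff x n)‖ < 1 := by
    rintro T ⟨q, hq, hqN', rfl⟩ n
    exact (haP _ _ (hPT q hq hqN')).2 n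
  have hm : ¬ p ∣ 1 := hp.not_dvd_one
  have hχm : (1 : DirichletCharacter ℂ N') ^ 1 = 1 := pow_one 1
  obtain ⟨g₁, a', hg₁0, hg₁χ, hTg⟩ := DeligneSerreLift.exists_eigenform_of_congruence ι hK1 hm hχm
    𝒯 hcomm hdiam hΛ a ha hxW hxint hx1 hcongr
  -- eigenvalues of `g₁`
  have hmemT : ∀ (q : ℕ), q.Prime → ¬ q ∣ N' → TL q ∈ 𝒯 := fun q hq hqN' ↦ ⟨q, hq, hqN', rfl⟩
  have ha'T : ∀ (q : ℕ), q.Prime → ¬ q ∣ N' → ‖a' (TL q) - A q‖ < 1 := by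
    intro q hq hqN'
    have h1 := (hTg _ (hmemT q hq hqN')).2.1
    have h2 := hPuniq _ _ _ (haP _ _ (hPT q hq hqN')) (hPT q hq hqN')
    exact norm_sub_lt_one_trans' h1 h2
  have hT : ∀ (q : ℕ) (hq : q.Prime), ¬ q ∣ N' →
      (haveI : NeZero q := ⟨hq.ne_zero⟩; heckeT (Gamma1 N') (k₀ + w) q) g₁ =
        ι (a' (TL q)) • g₁ := by
    intro q hq hqN'
    rw [← hTL q hq.ne_zero]
    exact (hTg _ (hmemT q hq hqN')).2.2
  -- ### `(D)` the newform behind `g₁` (Atkin–Lehner–Li), on `Γ₀`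
  obtain ⟨M, _, hMN, g₀, hg₀new, hg₀q, hg₀χ⟩ :=
    exists_isNewform1_of_eigenpacket hg₁0 hg₁χ (a := fun q ↦ ι (a' (TL q))) hT
  have hneb : nebentypus g₀ = 1 := by
    apply DirichletCharacter.changeLevel_injective hMN
    rw [hg₀χ, map_one]
  have hg₀diam : ∀ d : ZMod M, IsUnit d → diamondOp M (k₀ + w) d g₀ = g₀ := by
    intro d hd
    obtain ⟨u, rfl⟩ := hd
    have h := (mem_nebentypusSubspace_iff_diamondOp.mp
      (IsNewform1.mem_nebentypusSubspace_nebentypus_holds hg₀new)) u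
    rwa [hneb, MulChar.one_apply_coe, one_smul] at h
  obtain ⟨g, hg⟩ := exists_liftToGamma1_eq_of_forall_diamondOp_eq (k₀ + w) g₀ hg₀diam
  have hgnew : IsNewform0 g := by
    rw [← isNewform1_liftToGamma1_iff_holds (N := M) (k := k₀ + w) g, hg]
    exact hg₀new
  refine ⟨M, inferInstance, hMN, g, hgnew, fun q hq hqN' ↦ ?_⟩
  have hcoeff : (qExpansion 1 ⇑g).coeff q = cuspCoeff g₀ q := by
    rw [← hg]
    change _ = (qExpansion 1 ⇑(liftToGamma1 M (k₀ + w) g)).coeff q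
    rw [coe_liftToGamma1_holds M (k₀ + w) g]
  rw [hcoeff, hg₀q q hq hqN', RingEquiv.symm_apply_apply]
  exact ha'T q hq hqN'

end Multiplier

/-! ### The multiplier `E₂^{(M)}/(1 - M)` (Mazur's weight-2 Eisenstein series of prime level `M`) -/

section Mazur

variable {p : ℕ} [Fact p.Prime]

open scoped ArithmeticFunction.sigma in
/-- **Deligne–Serre companions of weight `k₀ + 2` from Mazur's Eisenstein series.**  Let `p` be a
prime, `ι : ℚ̄_p ≃ ℂ`, `f ∈ S_{k₀}(Γ₀(N))` a newform, `k₀ ≥ 2`, `N ∣ N'`, and `M ∣ N'` a PRIME with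
`‖24/(1 - M)‖_p < 1` (i.e. `v_p(24) > v_p(M - 1)`; at `p = 3`: `3 ∤ M - 1`; at `p = 2`: `8 ∤ M - 1`).
Then there are `M' ∣ N'` and a newform `g ∈ S_{k₀+2}(Γ₀(M'))` with `‖ι⁻¹ a_q(g) - ι⁻¹ a_q(f)‖ < 1`
for every prime `q ∤ N'`.  The multiplier is `G = E₂^{(M)}/(1 - M) ∈ M₂(Γ₀(M)) ⊆ M₂(Γ₀(N'))`,
`E₂^{(M)}(z) = E₂(z) - M E₂(Mz)` (`mazurEisensteinMF`; Diamond–Shurman §1.2, Mazur II.5), whose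
`q`-expansion `1 - (24/(1-M)) ∑ (σ₁(n) - M[M ∣ n]σ₁(n/M)) qⁿ` is `≡ 1` modulo `𝔪` under the stated
hypothesis; then `exists_isNewform0_dvd_level_congr_of_multiplier_of_dvd` with `w = 2` (`(p - 1) ∣ 2` for
`p = 2, 3`, the only primes at which the hypothesis can hold, but the statement is uniform).
[cite: DeligneSerreASENS1974, 6.9–6.11] [cite: DiamondShurman2005, §1.2 and Thm. 5.8.3] -/
theorem exists_isNewform0_dvd_level_congr_of_mazurMultiplier (ι : PadicAlgCl p ≃+* ℂ)
    {N N' M : ℕ} [NeZero N] [NeZero N'] (hNN' : N ∣ N') (hM : M.Prime) (hMN' : M ∣ N')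
    (hp2 : (p - 1) ∣ 2)
    (h24 : ‖(24 : PadicAlgCl p) / (1 - (M : PadicAlgCl p))‖ < 1)
    {k₀ : ℤ} (hk₀ : 2 ≤ k₀) {f : CuspForm (Gamma0 N) k₀} (hf : IsNewform0 f) :
    ∃ (M' : ℕ) (_ : NeZero M') (_ : M' ∣ N') (g : CuspForm (Gamma0 M') (k₀ + 2)),
      IsNewform0 g ∧
      ∀ q : ℕ, q.Prime → ¬ q ∣ N' →
        ‖ι.symm ((qExpansion 1 ⇑g).coeff q) - ι.symm ((qExpansion 1 ⇑f).coeff q)‖ < 1 := by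
  classical
  haveI : NeZero M := ⟨hM.ne_zero⟩
  -- `Γ₀(N') ≤ Γ₀(M)` on `SL(2, ℤ)`
  have hΓ : ∀ γ : SL(2, ℤ), γ ∈ Gamma0 N' → γ ∈ Gamma0 M := by
    intro γ hγ
    rw [Gamma0_mem] at hγ ⊢
    rw [ZMod.intCast_zmod_eq_zero_iff_dvd] at hγ ⊢
    exact (Int.natCast_dvd_natCast.mpr hMN').trans hγ
  -- the constant `c = (1 - M)⁻¹`
  have hM1 : (1 : ℂ) - (M : ℂ) ≠ 0 := by
    have h2 : (2 : ℝ) ≤ (M : ℝ) := by exact_mod_cast hM.two_le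
    intro h
    have h' : ((1 : ℝ) - (M : ℝ) : ℂ) = 0 := by push_cast; exact h
    have h'' : (1 : ℝ) - (M : ℝ) = 0 := by exact_mod_cast h'
    linarith
  set c : ℂ := (1 - (M : ℂ))⁻¹ with hc
  -- Mazur's form at level `N'`, scaled by `c`
  let F : ModularForm (Gamma1 N') 2 :=
    { toFun := mazurE2 M
      slash_action_eq' := fun A hA ↦ by
        obtain ⟨A, (hA : A ∈ Gamma1 N'), rfl⟩ := hA
        exact mazurE2_slash_of_mem_gamma0 M (hΓ A (Gamma1_in_Gamma0 N' hA))
      holo' := (mazurEisensteinMF M hM).holo'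
      bdd_at_cusps' := fun {cusp} hcusp ↦ by
        rw [Subgroup.IsArithmetic.isCusp_iff_isCusp_SL2Z] at hcusp
        rw [OnePoint.isBoundedAt_iff_forall_SL2Z hcusp]
        intro γ _
        exact isBoundedAtImInfty_mazurE2_slash M hM γ }
  have hFcoe : (⇑F : ℍ → ℂ) = ⇑(mazurEisensteinMF M hM) := rfl
  let G : ModularForm (Gamma1 N') 2 := c • F
  have hGcoe : (⇑G : ℍ → ℂ) = c • ⇑(mazurEisensteinMF M hM) := by
    rw [← hFcoe]; exact ModularForm.IsGLPos.coe_smul F c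
  -- `Γ₀(N')`-invariance
  have hGΓ : ∀ γ : SL(2, ℤ), γ ∈ Gamma0 N' → (⇑G : ℍ → ℂ) ∣[(2 : ℤ)] γ = ⇑G := by
    intro γ hγ
    rw [hGcoe, ModularForm.SL_smul_slash, mazurEisensteinMF_slash_of_mem_gamma0 M hM (hΓ γ hγ)]
  -- `q`-expansion of `G`
  have hGq : ∀ n, (qExpansion 1 ⇑G).coeff n =
      c * (qExpansion 1 ⇑(mazurEisensteinMF M hM)).coeff n := fun n ↦ by
    rw [hGcoe, qExpansion_smul (ModularFormClass.analyticAt_cuspFunction_zero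
      (mazurEisensteinMF M hM) one_pos (HeckeTGamma1.one_mem_strictPeriods_Gamma1 M)) c]
    simp
  have hG0 : (qExpansion 1 ⇑G).coeff 0 = 1 := by
    rw [hGq, qExpansion_coeff_mazurEisensteinMF, if_pos rfl, hc, inv_mul_cancel₀ hM1]
  have hGm : ∀ j : ℕ, j ≠ 0 → ‖ι.symm ((qExpansion 1 ⇑G).coeff j)‖ < 1 := by
    intro j hj
    rw [hGq, qExpansion_coeff_mazurEisensteinMF, if_neg hj]
    -- the coefficient is `(24/(1-M)) · Z` with `Z ∈ ℤ`
    obtain ⟨Z, hZ⟩ : ∃ Z : ℤ, ((σ 1 j : ℂ) - (M : ℂ) * (if M ∣ j then (σ 1 (j / M) : ℂ) else 0)) =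
        (Z : ℂ) := by
      by_cases hMj : M ∣ j
      · exact ⟨(σ 1 j : ℤ) - M * σ 1 (j / M), by rw [if_pos hMj]; push_cast; ring⟩
      · exact ⟨σ 1 j, by rw [if_neg hMj]; push_cast; ring⟩
    rw [hZ, hc, show (1 - (M : ℂ))⁻¹ * (-24 * (Z : ℂ)) = (24 : ℂ) / (1 - (M : ℂ)) * (-(Z : ℂ)) by
      field_simp, map_mul, map_neg, map_intCast, map_div₀, map_sub, map_one, map_natCast,
      map_ofNat, norm_mul, norm_neg]
    exact mul_lt_one_of_nonneg_of_lt_one_left (norm_nonneg _) h24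
      (DeligneSerreLift.norm_intCast_le_one Z)
  exact exists_isNewform0_dvd_level_congr_of_multiplier_of_dvd ι hNN' hk₀ hf hp2
    (show (2 : ℤ) = ((2 : ℕ) : ℤ) by norm_num) G hGΓ hG0 hGm

/-- `‖24‖₃ < 1` in `ℚ̄₃`, hence `‖24/(1 - M)‖₃ < 1` whenever `3 ∤ M - 1` (as integers). [folklore] -/
private theorem norm_twentyFour_div_lt_one_three [Fact (3 : ℕ).Prime] {M : ℕ}
    (hM : ¬ (3 : ℤ) ∣ (M : ℤ) - 1) :
    ‖(24 : PadicAlgCl 3) / (1 - (M : PadicAlgCl 3))‖ < 1 := by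
  have h24 : ‖(24 : PadicAlgCl 3)‖ < 1 := by
    have h := norm_intCast_lt_one_of_dvd' (p := 3) (z := 24) ⟨8, by norm_num⟩
    exact_mod_cast h
  have hden : ‖(1 : PadicAlgCl 3) - (M : PadicAlgCl 3)‖ = 1 := by
    have h := DeligneSerreLift.norm_intCast_eq_one_of_not_dvd (p := 3) (z := 1 - (M : ℤ))
      (fun h ↦ hM (by have := h.neg_right; simpa using this))
    push_cast at h
    exact h
  rw [norm_div, hden, div_one]
  exact h24

/-- `‖24/(1 - 2)‖₂ = ‖24‖₂ < 1` in `ℚ̄₂`. [folklore] -/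
private theorem norm_twentyFour_div_lt_one_two [Fact (2 : ℕ).Prime] :
    ‖(24 : PadicAlgCl 2) / (1 - ((2 : ℕ) : PadicAlgCl 2))‖ < 1 := by
  have h : (24 : PadicAlgCl 2) / (1 - ((2 : ℕ) : PadicAlgCl 2)) = ((-24 : ℤ) : PadicAlgCl 2) := by
    push_cast; ring
  rw [h]
  exact norm_intCast_lt_one_of_dvd' (p := 2) ⟨-12, by norm_num⟩

/-- **At `p = 3`, every newform has a congruent newform of weight `k₀ + 2` and level dividing `2N`.**
For a newform `f ∈ S_{k₀}(Γ₀(N))`, `k₀ ≥ 2`, and `ι : ℚ̄₃ ≃ ℂ`: there are `M' ∣ 2N` and a newform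
`g ∈ S_{k₀+2}(Γ₀(M'))` with `‖ι⁻¹ a_q(g) - ι⁻¹ a_q(f)‖₃ < 1` for every prime `q ∤ 2N` — the auxiliary
prime `2` (`E₂^{(2)}/(1-2) ≡ 1 (mod 3)`) replaces the Hasse invariant.  If `3 ∤ N` then `3 ∤ M'`.
[cite: DeligneSerreASENS1974, 6.9–6.11] [cite: DiamondShurman2005, §1.2 and Thm. 5.8.3] -/
theorem exists_isNewform0_dvd_two_mul_level_congr_weight_add_two_three [Fact (3 : ℕ).Prime]
    (ι : PadicAlgCl 3 ≃+* ℂ) {N : ℕ} [NeZero N]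
    {k₀ : ℤ} (hk₀ : 2 ≤ k₀) {f : CuspForm (Gamma0 N) k₀} (hf : IsNewform0 f) :
    ∃ (M' : ℕ) (_ : NeZero M') (_ : M' ∣ 2 * N) (g : CuspForm (Gamma0 M') (k₀ + 2)),
      IsNewform0 g ∧
      ∀ q : ℕ, q.Prime → ¬ q ∣ 2 * N →
        ‖ι.symm ((qExpansion 1 ⇑g).coeff q) - ι.symm ((qExpansion 1 ⇑f).coeff q)‖ < 1 :=
  haveI : NeZero (2 * N) := ⟨mul_ne_zero two_ne_zero (NeZero.ne N)⟩
  exists_isNewform0_dvd_level_congr_of_mazurMultiplier ι (Dvd.intro_left 2 rfl) Nat.prime_two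
    (Dvd.intro N rfl) (by norm_num) (norm_twentyFour_div_lt_one_three (M := 2) (by decide)) hk₀ hf

/-- **At `p = 3`, a congruent newform of weight `k₀ + 2` and level dividing `N` itself exists as
soon as `N` has a prime factor `M` with `3 ∤ M - 1`** (e.g. `2 ∣ N`, or a prime `≡ 2 (mod 3)`
dividing `N`): for a newform `f ∈ S_{k₀}(Γ₀(N))`, `k₀ ≥ 2`, `ι : ℚ̄₃ ≃ ℂ`, there are `M' ∣ N` and a
newform `g ∈ S_{k₀+2}(Γ₀(M'))` with `‖ι⁻¹ a_q(g) - ι⁻¹ a_q(f)‖₃ < 1` for all primes `q ∤ N`.  The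
complementary population (every prime factor of `N` is `≡ 1 (mod 3)`) is served by
`exists_isNewform0_dvd_two_mul_level_congr_weight_add_two_three` at level `2N` only.
[cite: DeligneSerreASENS1974, 6.9–6.11] [cite: DiamondShurman2005, §1.2 and Thm. 5.8.3] -/
theorem exists_isNewform0_dvd_level_congr_weight_add_two_three_of_prime_dvd [Fact (3 : ℕ).Prime]
    (ι : PadicAlgCl 3 ≃+* ℂ) {N M : ℕ} [NeZero N] (hM : M.Prime) (hMN : M ∣ N)
    (hM3 : ¬ (3 : ℤ) ∣ (M : ℤ) - 1)
    {k₀ : ℤ} (hk₀ : 2 ≤ k₀) {f : CuspForm (Gamma0 N) k₀} (hf : IsNewform0 f) :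
    ∃ (M' : ℕ) (_ : NeZero M') (_ : M' ∣ N) (g : CuspForm (Gamma0 M') (k₀ + 2)),
      IsNewform0 g ∧
      ∀ q : ℕ, q.Prime → ¬ q ∣ N →
        ‖ι.symm ((qExpansion 1 ⇑g).coeff q) - ι.symm ((qExpansion 1 ⇑f).coeff q)‖ < 1 :=
  exists_isNewform0_dvd_level_congr_of_mazurMultiplier ι (dvd_refl N) hM hMN (by norm_num)
    (norm_twentyFour_div_lt_one_three hM3) hk₀ hf

/-- **At `p = 2`, every newform has a congruent newform of weight `k₀ + 2` and level dividing `2N`**: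
for a newform `f ∈ S_{k₀}(Γ₀(N))`, `k₀ ≥ 2`, and `ι : ℚ̄₂ ≃ ℂ`, there are `M' ∣ 2N` and a newform
`g ∈ S_{k₀+2}(Γ₀(M'))` with `‖ι⁻¹ a_q(g) - ι⁻¹ a_q(f)‖₂ < 1` for every prime `q ∤ 2N`
(`E₂^{(2)}/(1-2) = 1 + 24 ∑ (σ₁(n) - 2[2 ∣ n]σ₁(n/2)) qⁿ ≡ 1 (mod 8)`).
[cite: DeligneSerreASENS1974, 6.9–6.11] [cite: DiamondShurman2005, §1.2 and Thm. 5.8.3] -/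
theorem exists_isNewform0_dvd_two_mul_level_congr_weight_add_two_two [Fact (2 : ℕ).Prime]
    (ι : PadicAlgCl 2 ≃+* ℂ) {N : ℕ} [NeZero N]
    {k₀ : ℤ} (hk₀ : 2 ≤ k₀) {f : CuspForm (Gamma0 N) k₀} (hf : IsNewform0 f) :
    ∃ (M' : ℕ) (_ : NeZero M') (_ : M' ∣ 2 * N) (g : CuspForm (Gamma0 M') (k₀ + 2)),
      IsNewform0 g ∧
      ∀ q : ℕ, q.Prime → ¬ q ∣ 2 * N →
        ‖ι.symm ((qExpansion 1 ⇑g).coeff q) - ι.symm ((qExpansion 1 ⇑f).coeff q)‖ < 1 :=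
  haveI : NeZero (2 * N) := ⟨mul_ne_zero two_ne_zero (NeZero.ne N)⟩
  exists_isNewform0_dvd_level_congr_of_mazurMultiplier ι (Dvd.intro_left 2 rfl) Nat.prime_two
    (Dvd.intro N rfl) (by norm_num) norm_twentyFour_div_lt_one_two hk₀ hf

end Mazur

end Literature.NumberTheory.EllipticCurves.ModularForms

end
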